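import Summits.Ventures.HSemireg.Pad4TowerLineDesignCert10Closure

/-!
# Pad4Tower ∕ LineDesignCert10 — KERNEL DECIDES (3∕5, `XPlus1`): guarded X⁺ (the `X` family of the dual-0 world `c10d`) at dual heads of chunks 1–19 of 57

LINE-10 KERNEL CERTIFICATE (typer-1 g3 on control g10's KEY (b)): each theorem of this module is one static-family check (`decide +kernel`) at a few heads of the
design `c10` of `Pad4TowerLineDesignCert10Closure`; the module boundary is set by the gate's build budget only; the assembly is in `Pad4TowerLineDesignCert10`.

MODULE SET (tree cut of ONE certificate; one namespace `Summit.Ventures.HSemireg.Pad4Tower.LineDesignCert10`): `…Cert10DataN` ∕ `DataP` ∕ `DataPd` ∕ `DataNd` (the support and its literal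
dual-0 world, DATA ONLY) → `…Cert10Closure` (key-chain `Nodup`, the design `c10`, the literal dual `c10d` and `c10_dual_eq`, ◇₁₀, the ceiling line, per-chunk
G₁ closure ⇒ `c10` is Δ- and S₄-closed) → `…Cert10RuleD1` ∕ `…Cert10RuleD2` ∕ `…Cert10XPlus1` ∕ `…Cert10XPlus2` ∕ `…Cert10XPlus3` (the RULE D (μ₄, M) resp. guarded X⁺ decides, a few heads per
theorem, module boundaries set by the gate's build budget only) → `Pad4TowerLineDesignCert10` (assembly `c10_staticH1`; the EVEN word `¬ c10.HasOddFC`; the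
certified FC cell `P[8I+ℓ₋₁|8I+ℓ₋₁|8I+ℓ₁|8I+ℓ₁]` of phase type 2+2 («antipodal mix») at the upper level ⇒ `CellRealisable 10 false`, the LINE-realisable shape,
every support cell's realisability). Generic reductions (`key`, `nodup_of_keys`, `swapClosed_of_gens`, `xresXClosed_iff_guarded'`, `a2iMinusClosed_of_onCeiling`)
are the TREE's (`Pad4TowerLineDesignCert12Closure` ∕ `Pad4TowerLineDesignCert12`), imported — nothing generic is re-declared.

NOTHING IN THIS MODULE SET SAYS THAT HC ∕ HC_CM ∕ HC_AV ∕ H2 ∕ stmt-HodgeConjecture-18881 ∕ (T₈) ∕ (T₁₀) HOLDS OR FAILS (HC_CM is a displayed binder of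
the ladder only); the certified statements concern the typed FIRST-ORDER static game (`RuleDMu4Closed`, `XPlusClosed`, `A2IMinusClosed` = `MConfig.StaticH1`)
of ONE explicit finite support — first order is necessary, not sufficient, for a seed; no σ, no seed, no census row; the design is EVEN (no odd fully-charged
cell), hence CONSISTENT with (T₁₀) and silent about it. `decide +kernel` only: NO `native_decide`, no `sorry`, no `axiom`, no `instance`, no notation, no
Literature fact, no new `def … : Prop`.
-/

set_option linter.dupNamespace false

namespace Summit.Ventures.HSemireg.Pad4Tower.LineDesignCert10

open Summit.Ventures.HSemireg Summit.Ventures.HSemireg.Pad4Tower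

set_option maxRecDepth 32768
set_option Elab.async false
set_option synthInstance.maxSize 8192
set_option synthInstance.maxHeartbeats 2000000
set_option maxHeartbeats 8000000

/-! guarded X⁺ (the `X` family of the dual-0 world `c10d`), heads chunked (6 per theorem) -/

/-- no `X`-family instance of the dual-0 world fires at the heads of dual chunk 1∕57 (guarded form, `LineDesignCert12.xresXClosed_iff_guarded'`). [kernel `decide`] -/
theorem xplus_1 : ∀ Z ∈ l10Pd_1, ∀ σ : Fin 4, ¬ isApex (Z σ) → ∀ u : Fin 4, ∀ q ∈ s10Nd, UPartner Z q σ u → ∀ w : Fin 4, ∀ n ∈ s10Pd,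
    Sibling q n σ w → ∀ f : Fin 4, ¬ XresXFires c10d Z q n σ u w f := by decide +kernel
/-- no `X`-family instance of the dual-0 world fires at the heads of dual chunk 2∕57 (guarded form, `LineDesignCert12.xresXClosed_iff_guarded'`). [kernel `decide`] -/
theorem xplus_2 : ∀ Z ∈ l10Pd_2, ∀ σ : Fin 4, ¬ isApex (Z σ) → ∀ u : Fin 4, ∀ q ∈ s10Nd, UPartner Z q σ u → ∀ w : Fin 4, ∀ n ∈ s10Pd,
    Sibling q n σ w → ∀ f : Fin 4, ¬ XresXFires c10d Z q n σ u w f := by decide +kernel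
/-- no `X`-family instance of the dual-0 world fires at the heads of dual chunk 3∕57 (guarded form, `LineDesignCert12.xresXClosed_iff_guarded'`). [kernel `decide`] -/
theorem xplus_3 : ∀ Z ∈ l10Pd_3, ∀ σ : Fin 4, ¬ isApex (Z σ) → ∀ u : Fin 4, ∀ q ∈ s10Nd, UPartner Z q σ u → ∀ w : Fin 4, ∀ n ∈ s10Pd,
    Sibling q n σ w → ∀ f : Fin 4, ¬ XresXFires c10d Z q n σ u w f := by decide +kernel
/-- no `X`-family instance of the dual-0 world fires at the heads of dual chunk 4∕57 (guarded form, `LineDesignCert12.xresXClosed_iff_guarded'`). [kernel `decide`] -/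
theorem xplus_4 : ∀ Z ∈ l10Pd_4, ∀ σ : Fin 4, ¬ isApex (Z σ) → ∀ u : Fin 4, ∀ q ∈ s10Nd, UPartner Z q σ u → ∀ w : Fin 4, ∀ n ∈ s10Pd,
    Sibling q n σ w → ∀ f : Fin 4, ¬ XresXFires c10d Z q n σ u w f := by decide +kernel
/-- no `X`-family instance of the dual-0 world fires at the heads of dual chunk 5∕57 (guarded form, `LineDesignCert12.xresXClosed_iff_guarded'`). [kernel `decide`] -/
theorem xplus_5 : ∀ Z ∈ l10Pd_5, ∀ σ : Fin 4, ¬ isApex (Z σ) → ∀ u : Fin 4, ∀ q ∈ s10Nd, UPartner Z q σ u → ∀ w : Fin 4, ∀ n ∈ s10Pd,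
    Sibling q n σ w → ∀ f : Fin 4, ¬ XresXFires c10d Z q n σ u w f := by decide +kernel
/-- no `X`-family instance of the dual-0 world fires at the heads of dual chunk 6∕57 (guarded form, `LineDesignCert12.xresXClosed_iff_guarded'`). [kernel `decide`] -/
theorem xplus_6 : ∀ Z ∈ l10Pd_6, ∀ σ : Fin 4, ¬ isApex (Z σ) → ∀ u : Fin 4, ∀ q ∈ s10Nd, UPartner Z q σ u → ∀ w : Fin 4, ∀ n ∈ s10Pd,
    Sibling q n σ w → ∀ f : Fin 4, ¬ XresXFires c10d Z q n σ u w f := by decide +kernel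
/-- no `X`-family instance of the dual-0 world fires at the heads of dual chunk 7∕57 (guarded form, `LineDesignCert12.xresXClosed_iff_guarded'`). [kernel `decide`] -/
theorem xplus_7 : ∀ Z ∈ l10Pd_7, ∀ σ : Fin 4, ¬ isApex (Z σ) → ∀ u : Fin 4, ∀ q ∈ s10Nd, UPartner Z q σ u → ∀ w : Fin 4, ∀ n ∈ s10Pd,
    Sibling q n σ w → ∀ f : Fin 4, ¬ XresXFires c10d Z q n σ u w f := by decide +kernel
/-- no `X`-family instance of the dual-0 world fires at the heads of dual chunk 8∕57 (guarded form, `LineDesignCert12.xresXClosed_iff_guarded'`). [kernel `decide`] -/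
theorem xplus_8 : ∀ Z ∈ l10Pd_8, ∀ σ : Fin 4, ¬ isApex (Z σ) → ∀ u : Fin 4, ∀ q ∈ s10Nd, UPartner Z q σ u → ∀ w : Fin 4, ∀ n ∈ s10Pd,
    Sibling q n σ w → ∀ f : Fin 4, ¬ XresXFires c10d Z q n σ u w f := by decide +kernel
/-- no `X`-family instance of the dual-0 world fires at the heads of dual chunk 9∕57 (guarded form, `LineDesignCert12.xresXClosed_iff_guarded'`). [kernel `decide`] -/
theorem xplus_9 : ∀ Z ∈ l10Pd_9, ∀ σ : Fin 4, ¬ isApex (Z σ) → ∀ u : Fin 4, ∀ q ∈ s10Nd, UPartner Z q σ u → ∀ w : Fin 4, ∀ n ∈ s10Pd,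
    Sibling q n σ w → ∀ f : Fin 4, ¬ XresXFires c10d Z q n σ u w f := by decide +kernel
/-- no `X`-family instance of the dual-0 world fires at the heads of dual chunk 10∕57 (guarded form, `LineDesignCert12.xresXClosed_iff_guarded'`). [kernel `decide`] -/
theorem xplus_10 : ∀ Z ∈ l10Pd_10, ∀ σ : Fin 4, ¬ isApex (Z σ) → ∀ u : Fin 4, ∀ q ∈ s10Nd, UPartner Z q σ u → ∀ w : Fin 4, ∀ n ∈ s10Pd,
    Sibling q n σ w → ∀ f : Fin 4, ¬ XresXFires c10d Z q n σ u w f := by decide +kernel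
/-- no `X`-family instance of the dual-0 world fires at the heads of dual chunk 11∕57 (guarded form, `LineDesignCert12.xresXClosed_iff_guarded'`). [kernel `decide`] -/
theorem xplus_11 : ∀ Z ∈ l10Pd_11, ∀ σ : Fin 4, ¬ isApex (Z σ) → ∀ u : Fin 4, ∀ q ∈ s10Nd, UPartner Z q σ u → ∀ w : Fin 4, ∀ n ∈ s10Pd,
    Sibling q n σ w → ∀ f : Fin 4, ¬ XresXFires c10d Z q n σ u w f := by decide +kernel
/-- no `X`-family instance of the dual-0 world fires at the heads of dual chunk 12∕57 (guarded form, `LineDesignCert12.xresXClosed_iff_guarded'`). [kernel `decide`] -/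
theorem xplus_12 : ∀ Z ∈ l10Pd_12, ∀ σ : Fin 4, ¬ isApex (Z σ) → ∀ u : Fin 4, ∀ q ∈ s10Nd, UPartner Z q σ u → ∀ w : Fin 4, ∀ n ∈ s10Pd,
    Sibling q n σ w → ∀ f : Fin 4, ¬ XresXFires c10d Z q n σ u w f := by decide +kernel
/-- no `X`-family instance of the dual-0 world fires at the heads of dual chunk 13∕57 (guarded form, `LineDesignCert12.xresXClosed_iff_guarded'`). [kernel `decide`] -/
theorem xplus_13 : ∀ Z ∈ l10Pd_13, ∀ σ : Fin 4, ¬ isApex (Z σ) → ∀ u : Fin 4, ∀ q ∈ s10Nd, UPartner Z q σ u → ∀ w : Fin 4, ∀ n ∈ s10Pd,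
    Sibling q n σ w → ∀ f : Fin 4, ¬ XresXFires c10d Z q n σ u w f := by decide +kernel
/-- no `X`-family instance of the dual-0 world fires at the heads of dual chunk 14∕57 (guarded form, `LineDesignCert12.xresXClosed_iff_guarded'`). [kernel `decide`] -/
theorem xplus_14 : ∀ Z ∈ l10Pd_14, ∀ σ : Fin 4, ¬ isApex (Z σ) → ∀ u : Fin 4, ∀ q ∈ s10Nd, UPartner Z q σ u → ∀ w : Fin 4, ∀ n ∈ s10Pd,
    Sibling q n σ w → ∀ f : Fin 4, ¬ XresXFires c10d Z q n σ u w f := by decide +kernel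
/-- no `X`-family instance of the dual-0 world fires at the heads of dual chunk 15∕57 (guarded form, `LineDesignCert12.xresXClosed_iff_guarded'`). [kernel `decide`] -/
theorem xplus_15 : ∀ Z ∈ l10Pd_15, ∀ σ : Fin 4, ¬ isApex (Z σ) → ∀ u : Fin 4, ∀ q ∈ s10Nd, UPartner Z q σ u → ∀ w : Fin 4, ∀ n ∈ s10Pd,
    Sibling q n σ w → ∀ f : Fin 4, ¬ XresXFires c10d Z q n σ u w f := by decide +kernel
/-- no `X`-family instance of the dual-0 world fires at the heads of dual chunk 16∕57 (guarded form, `LineDesignCert12.xresXClosed_iff_guarded'`). [kernel `decide`] -/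
theorem xplus_16 : ∀ Z ∈ l10Pd_16, ∀ σ : Fin 4, ¬ isApex (Z σ) → ∀ u : Fin 4, ∀ q ∈ s10Nd, UPartner Z q σ u → ∀ w : Fin 4, ∀ n ∈ s10Pd,
    Sibling q n σ w → ∀ f : Fin 4, ¬ XresXFires c10d Z q n σ u w f := by decide +kernel
/-- no `X`-family instance of the dual-0 world fires at the heads of dual chunk 17∕57 (guarded form, `LineDesignCert12.xresXClosed_iff_guarded'`). [kernel `decide`] -/
theorem xplus_17 : ∀ Z ∈ l10Pd_17, ∀ σ : Fin 4, ¬ isApex (Z σ) → ∀ u : Fin 4, ∀ q ∈ s10Nd, UPartner Z q σ u → ∀ w : Fin 4, ∀ n ∈ s10Pd,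
    Sibling q n σ w → ∀ f : Fin 4, ¬ XresXFires c10d Z q n σ u w f := by decide +kernel
/-- no `X`-family instance of the dual-0 world fires at the heads of dual chunk 18∕57 (guarded form, `LineDesignCert12.xresXClosed_iff_guarded'`). [kernel `decide`] -/
theorem xplus_18 : ∀ Z ∈ l10Pd_18, ∀ σ : Fin 4, ¬ isApex (Z σ) → ∀ u : Fin 4, ∀ q ∈ s10Nd, UPartner Z q σ u → ∀ w : Fin 4, ∀ n ∈ s10Pd,
    Sibling q n σ w → ∀ f : Fin 4, ¬ XresXFires c10d Z q n σ u w f := by decide +kernel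
/-- no `X`-family instance of the dual-0 world fires at the heads of dual chunk 19∕57 (guarded form, `LineDesignCert12.xresXClosed_iff_guarded'`). [kernel `decide`] -/
theorem xplus_19 : ∀ Z ∈ l10Pd_19, ∀ σ : Fin 4, ¬ isApex (Z σ) → ∀ u : Fin 4, ∀ q ∈ s10Nd, UPartner Z q σ u → ∀ w : Fin 4, ∀ n ∈ s10Pd,
    Sibling q n σ w → ∀ f : Fin 4, ¬ XresXFires c10d Z q n σ u w f := by decide +kernel

end Summit.Ventures.HSemireg.Pad4Tower.LineDesignCert10
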